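import Literature.NumberTheory.Sieve.QuadraticPhaseRecurrence
import Literature.NumberTheory.Sieve.VinogradovExpSumTools
import Summits.Parity.GeneralizedHardyLittlewood.Theorems.GreenTaoLevelTwoMNTwoRecurrentLinear

/-!
# Route `GreenTaoLevelTwo`, crux `MNTwo` (stmt-Parity-21276), line `birth`, stub `stub_mnVertical`:
# recurrent quadratics are non-diophantine (GT 2008b App. A, Lemma 40)

Tool for block V5 (= AIF §11) of the `stub_mnVertical` census (B. Green, T. Tao, *Quadratic
uniformity of the Möbius function*, Ann. Inst. Fourier 58 (2008) = arXiv:math/0606087, Appendix A,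
Lemma 40 "Recurrent quadratics are non-diophantine": if `‖αl² + βl + γ‖_{ℝ/ℤ} ≤ δ₁` for at least
`δ₂|I|` elements `l` of an interval `I`, `δ₁ ≤ δ₂/4`, then `‖qα‖_{ℝ/ℤ} ≲_{δ₂} |I|⁻²` for some
`q ≲_{δ₂} 1`; "One can now repeat the proof of Lemma (lem3.1)(i), using Lemma (weyl-ineq) in place
of (exponential-sum)").  We follow exactly that instruction: the Erdős–Turán step is the one of
`…MNTwoRecurrentLinear.exists_norm_mul_le_of_many_small` (tree `erdosTuran_arc`, Travaglini's
constants), producing a frequency `d₀ ≤ 3209/δ₂` with `|Σ_l e(d₀(αl²+βl+γ))| ≥ δ₂²L/20550436`, and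
the Weyl step is the tree's inverse quadratic Weyl inequality
`QuadraticMoebius.exists_distInt_mul_le_of_norm_quadratic_sum_ge` (non-explicit exponent `A` and
constant `C`, as there).  This is the lemma invoked in the proof of AIF Lemma 26 ("Now Lemma (lem4.6)
applies to exactly this kind of situation").  Def-free.

* `expSum_quadratic_eq` — the exponential sums of the point set `(αl²+βl+γ)_{l=1}^{L}` are Weyl sums;
* `exists_norm_mul_le_of_quadratic_recurrent` — **Lemma 40**: `∃ A C`, for all data,
  `∃ 1 ≤ q ≤ C/δ₂^A` with `‖qα‖_{ℝ/ℤ} ≤ C/(δ₂^A L²)`.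

References: [GreenTao2008QuadraticMobius] arXiv:math/0606087 App. A, Lemma 40 (and Lemma 32 (i),
Lemma 39).
-/

noncomputable section

open Finset Real
open scoped FourierTransform

namespace Summit.Parity.GeneralizedHardyLittlewood.GreenTaoLevelTwoMNTwoQuadraticRecurrent

open Literature.Analysis.Fourier.TrigApprox (e e_add norm_e expSum distZ erdosTuran_arc)
open Literature.NumberTheory.Sieve.Vinogradov (distInt distInt_eq_norm_coe)
open Literature.NumberTheory.Sieve.QuadraticMoebius (exists_distInt_mul_le_of_norm_quadratic_sum_ge)
open Summit.Parity.GeneralizedHardyLittlewood.GreenTaoLevelTwoMNTwoRecurrentLinear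
  (distZ_eq_norm card_filter_Icc_eq_card_filter_fin)

/-- The exponential sums of the quadratic point set `ω_n = α(n+1)² + β(n+1) + γ` (`n < L`) are Weyl
sums: `S(d) = e(dγ) · Σ_{0<l≤L} e((dα)l² + (dβ)l)`. [folklore] -/
theorem expSum_quadratic_eq (α β γ : ℝ) (L : ℕ) (d : ℤ) :
    expSum (fun n : Fin L => α * (((n : ℕ) : ℝ) + 1) ^ 2 + β * (((n : ℕ) : ℝ) + 1) + γ) d =
      (𝐞 ((d : ℝ) * γ) : ℂ) *
        ∑ l ∈ Ioc 0 (0 + L), (𝐞 (((d : ℝ) * α) * (l : ℝ) ^ 2 + ((d : ℝ) * β) * l) : ℂ) := by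
  unfold expSum
  rw [zero_add, ← Finset.Icc_add_one_left_eq_Ioc, zero_add, Finset.mul_sum]
  have himg : (Finset.univ : Finset (Fin L)).image (fun n : Fin L => (n : ℕ) + 1) = Icc 1 L := by
    ext x
    simp only [mem_image, mem_univ, true_and, mem_Icc]
    constructor
    · rintro ⟨n, rfl⟩; exact ⟨by omega, by omega⟩
    · rintro ⟨h1, h2⟩; exact ⟨⟨x - 1, by omega⟩, by simp only; omega⟩
  rw [← himg, Finset.sum_image (fun a _ b _ h => by simp only [add_left_inj] at h; exact Fin.ext h)]
  refine Finset.sum_congr rfl fun n _ => ?_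
  -- the tree's `e(t) = exp(2πit)` is Mathlib's additive character `𝐞 t`
  have e_eq_fourierChar : ∀ t : ℝ, e t = (𝐞 t : ℂ) := fun t => by
    rw [Real.fourierChar_apply]
    unfold e
    push_cast
    ring_nf
  rw [e_eq_fourierChar, ← Circle.coe_mul, ← AddChar.map_add_eq_mul]
  congr 2
  push_cast
  ring

/-- **Recurrent quadratics are non-diophantine (GT 2008b Lemma 40).**  There are `A ∈ ℕ` and
`C ≥ 1` such that: if `0 < δ₂ ≤ 1`, `0 ≤ δ₁ ≤ δ₂/4`, `L ≥ 1`, and at least `δ₂L` integers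
`l ∈ {1,…,L}` have `‖αl² + βl + γ‖_{ℝ/ℤ} ≤ δ₁`, then some `1 ≤ q ≤ C/δ₂^A` has
`‖qα‖_{ℝ/ℤ} ≤ C/(δ₂^A L²)`.  ("Repeat the proof of Lemma 32 (i), using Weyl's inequality in place of
(exponential-sum)": Erdős–Turán gives `d₀ ≤ 3209/δ₂` with `|Σ_{l≤L} e(d₀(αl²+βl+γ))| ≥ δ₂²L/20550436`;
the inverse Weyl inequality then gives `k` with `‖k d₀ α‖ ≲ L⁻²`.)
[cite: GreenTao2008QuadraticMobius, App. A, Lemma 40] -/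
theorem exists_norm_mul_le_of_quadratic_recurrent :
    ∃ (A : ℕ) (C : ℝ), 1 ≤ C ∧
      ∀ (α β γ : ℝ) (L : ℕ) (δ₁ δ₂ : ℝ), 0 < δ₂ → δ₂ ≤ 1 → 0 ≤ δ₁ → δ₁ ≤ δ₂ / 4 → 1 ≤ L →
        δ₂ * L ≤ #((Icc 1 L).filter fun l : ℕ =>
          ‖((α * (l : ℝ) ^ 2 + β * l + γ : ℝ) : UnitAddCircle)‖ ≤ δ₁) →
        ∃ q : ℕ, 1 ≤ q ∧ (q : ℝ) ≤ C / δ₂ ^ A ∧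
          ‖((((q : ℝ) * α : ℝ)) : UnitAddCircle)‖ ≤ C / (δ₂ ^ A * (L : ℝ) ^ 2) := by
  classical
  obtain ⟨A, C, hC1, hW⟩ := exists_distInt_mul_le_of_norm_quadratic_sum_ge
  -- constants: `η = δ₂²/c₁`, `8/η² = c₀/δ₂⁴`
  set c₁ : ℝ := 20550436 with hc₁
  set c₀ : ℝ := 8 * c₁ ^ 2 with hc₀
  refine ⟨4 * A + 1, 3209 * C * c₀ ^ A, ?_, ?_⟩
  · have h1 : (1 : ℝ) ≤ c₀ ^ A := one_le_pow₀ (by rw [hc₀, hc₁]; norm_num)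
    nlinarith
  intro α β γ L δ₁ δ₂ hδ₂ hδ₂1 hδ₁ hδ₁₂ hL hcount
  have hLpos : (0 : ℝ) < L := by exact_mod_cast hL
  -- the point set
  set ω : Fin L → ℝ := fun n => α * (((n : ℕ) : ℝ) + 1) ^ 2 + β * (((n : ℕ) : ℝ) + 1) + γ with hω
  -- the count, read on `Fin L`
  have hcount' : δ₂ * L ≤
      #((Finset.univ : Finset (Fin L)).filter fun n : Fin L => distZ (ω n - 0) ≤ δ₁) := by
    rw [card_filter_Icc_eq_card_filter_fin] at hcount
    refine hcount.trans (le_of_eq ?_)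
    norm_cast
    refine congrArg Finset.card (Finset.filter_congr fun n _ => ?_)
    simp only [hω, sub_zero, distZ_eq_norm]
    push_cast
    ring_nf
  -- Erdős–Turán with `H = ⌈3208/δ₂⌉`
  set H : ℕ := ⌈3208 / δ₂⌉₊ with hHdef
  have hHge : 3208 / δ₂ ≤ H := Nat.le_ceil _
  have hH1 : 1 ≤ H := by
    have : (1 : ℝ) ≤ 3208 / δ₂ := by rw [le_div_iff₀ hδ₂]; linarith
    exact_mod_cast this.trans hHge
  have hHpos : (0 : ℝ) < H := by exact_mod_cast hH1
  have hHle : (H : ℝ) ≤ 3209 / δ₂ := by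
    have h1 : (H : ℝ) < 3208 / δ₂ + 1 := Nat.ceil_lt_add_one (by positivity)
    have h2 : (1 : ℝ) ≤ 1 / δ₂ := by rw [le_div_iff₀ hδ₂]; linarith
    have : 3208 / δ₂ + 1 ≤ 3209 / δ₂ := by
      rw [div_add_one hδ₂.ne', div_le_div_iff_of_pos_right hδ₂]; linarith
    linarith
  have hET := erdosTuran_arc ω 0 hδ₁ (by linarith) hH1
  -- lower bound for the weighted exponential-sum total
  set T : ℝ := ∑ d ∈ Icc 1 H, ‖expSum ω d‖ / d with hT
  have hT0 : 0 ≤ T := Finset.sum_nonneg fun d _ => by positivity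
  have hTlow : δ₂ * L / 6404 ≤ T := by
    have h1 : δ₂ * L / 2 ≤ 802 * L / H + (2 / π + 1600) * T := by
      have habs := (le_abs_self _).trans hET
      have : 2 * δ₁ * (L : ℝ) ≤ δ₂ * L / 2 := by nlinarith
      linarith
    have h2 : 802 * (L : ℝ) / H ≤ δ₂ * L / 4 := by
      rw [div_le_div_iff₀ hHpos (by norm_num : (0 : ℝ) < 4)]
      have : 802 * 4 ≤ δ₂ * H := by
        have := mul_le_mul_of_nonneg_left hHge hδ₂.le
        rw [mul_div_cancel₀ _ hδ₂.ne'] at this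
        linarith
      nlinarith
    have hπ : 2 / π + 1600 ≤ (1601 : ℝ) := by
      have : 2 / π ≤ 1 := by
        rw [div_le_one Real.pi_pos]; linarith [Real.pi_gt_three]
      linarith
    have h3 : (2 / π + 1600) * T ≤ 1601 * T := mul_le_mul_of_nonneg_right hπ hT0
    have h4 : δ₂ * L / 4 ≤ 1601 * T := by linarith
    have : δ₂ * L / 6404 = (δ₂ * L / 4) / 1601 := by ring
    rw [this, div_le_iff₀ (by norm_num : (0 : ℝ) < 1601)]
    linarith
  -- a frequency with a large exponential sum
  obtain ⟨d₀, hd₀, hmax⟩ := Finset.exists_max_image (Icc 1 H) (fun d : ℕ => ‖expSum ω d‖ / d)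
    ⟨1, by rw [mem_Icc]; exact ⟨le_rfl, hH1⟩⟩
  rw [mem_Icc] at hd₀
  have hd₀pos : (0 : ℝ) < d₀ := by exact_mod_cast hd₀.1
  have hTle : T ≤ H * (‖expSum ω d₀‖ / d₀) := by
    calc T ≤ ∑ _d ∈ Icc 1 H, ‖expSum ω d₀‖ / d₀ := Finset.sum_le_sum fun d hd => hmax d hd
      _ = H * (‖expSum ω d₀‖ / d₀) := by
          rw [Finset.sum_const, Nat.card_Icc, nsmul_eq_mul]; push_cast; ring
  have hS : δ₂ ^ 2 * L / c₁ ≤ ‖expSum ω d₀‖ := by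
    have h1 : ‖expSum ω d₀‖ / d₀ ≤ ‖expSum ω d₀‖ := by
      rw [div_le_iff₀ hd₀pos]
      have : (1 : ℝ) ≤ d₀ := by exact_mod_cast hd₀.1
      nlinarith [norm_nonneg (expSum ω d₀)]
    have h2 : δ₂ * L / 6404 ≤ H * ‖expSum ω d₀‖ := by
      have := hTlow.trans hTle
      nlinarith [norm_nonneg (expSum ω d₀), hHpos.le]
    have h3 : (H : ℝ) * ‖expSum ω d₀‖ ≤ 3209 / δ₂ * ‖expSum ω d₀‖ :=
      mul_le_mul_of_nonneg_right hHle (norm_nonneg _)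
    have h4 : δ₂ * L / 6404 ≤ 3209 / δ₂ * ‖expSum ω d₀‖ := h2.trans h3
    rw [div_mul_eq_mul_div, le_div_iff₀ hδ₂] at h4
    have : δ₂ ^ 2 * L / c₁ = (δ₂ * L / 6404 * δ₂) / 3209 := by rw [hc₁]; ring
    rw [this, div_le_iff₀ (by norm_num : (0 : ℝ) < 3209)]
    linarith
  -- the Weyl sum
  have hWeyl : δ₂ ^ 2 / c₁ * L ≤
      ‖∑ l ∈ Ioc 0 (0 + L), (𝐞 ((((d₀ : ℕ) : ℤ) : ℝ) * α * (l : ℝ) ^ 2 +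
        (((d₀ : ℕ) : ℤ) : ℝ) * β * l) : ℂ)‖ := by
    have h := hS
    rw [hω, expSum_quadratic_eq, norm_mul, Circle.norm_coe, one_mul] at h
    calc δ₂ ^ 2 / c₁ * L = δ₂ ^ 2 * L / c₁ := by ring
      _ ≤ _ := h
  have hη : 0 < δ₂ ^ 2 / c₁ := by positivity
  have hη1 : δ₂ ^ 2 / c₁ ≤ 1 := by
    rw [div_le_one (by rw [hc₁]; norm_num)]
    have : δ₂ ^ 2 ≤ 1 := pow_le_one₀ hδ₂.le hδ₂1
    rw [hc₁]; linarith
  obtain ⟨k, hk1, hkC, hdist⟩ := hW (δ₂ ^ 2 / c₁) 0 L _ _ hη hη1 hL hWeyl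
  -- bookkeeping of the constants
  have hδA : 0 < δ₂ ^ (4 * A) := pow_pos hδ₂ _
  have hδA1 : δ₂ ^ (4 * A + 1) ≤ δ₂ ^ (4 * A) := by
    rw [pow_succ]; exact mul_le_of_le_one_right hδA.le hδ₂1
  have hkey : (8 / (δ₂ ^ 2 / c₁) ^ 2) ^ A = c₀ ^ A / δ₂ ^ (4 * A) := by
    rw [pow_mul, ← div_pow]
    congr 1
    rw [hc₀]
    field_simp
  rw [hkey] at hkC hdist
  have hd₀R : ((((d₀ : ℕ) : ℤ) : ℝ)) = (d₀ : ℝ) := by push_cast; ring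
  rw [hd₀R] at hdist
  refine ⟨k * d₀, Nat.one_le_iff_ne_zero.2 (Nat.mul_ne_zero (by omega) (by omega)), ?_, ?_⟩
  · -- `k d₀ ≤ C c₀^A/δ₂^{4A} · 3209/δ₂`
    push_cast
    have hd₀le : (d₀ : ℝ) ≤ 3209 / δ₂ := (show (d₀ : ℝ) ≤ H by exact_mod_cast hd₀.2).trans hHle
    calc (k : ℝ) * d₀ ≤ C * (c₀ ^ A / δ₂ ^ (4 * A)) * (3209 / δ₂) :=
          mul_le_mul hkC hd₀le hd₀pos.le (by positivity)
      _ = 3209 * C * c₀ ^ A / δ₂ ^ (4 * A + 1) := by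
          rw [pow_succ]; field_simp
  · -- `‖k d₀ α‖ ≤ C c₀^A/(δ₂^{4A} L²) ≤ 3209 C c₀^A/(δ₂^{4A+1} L²)`
    have e1 : (((k * d₀ : ℕ) : ℝ) * α) = (k : ℝ) * ((d₀ : ℝ) * α) := by push_cast; ring
    rw [e1, ← distInt_eq_norm_coe]
    refine hdist.trans ?_
    rw [mul_div_assoc', div_div, div_le_div_iff₀ (by positivity) (by positivity)]
    have hC0 : 0 ≤ C := by linarith
    have h1 : C * c₀ ^ A * (δ₂ ^ (4 * A + 1) * (L : ℝ) ^ 2) ≤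
        C * c₀ ^ A * (δ₂ ^ (4 * A) * (L : ℝ) ^ 2) := by
      apply mul_le_mul_of_nonneg_left _ (by positivity)
      exact mul_le_mul_of_nonneg_right hδA1 (by positivity)
    have h2 : C * c₀ ^ A * (δ₂ ^ (4 * A) * (L : ℝ) ^ 2) ≤
        3209 * C * c₀ ^ A * (δ₂ ^ (4 * A) * (L : ℝ) ^ 2) := by
      have : 0 ≤ C * c₀ ^ A * (δ₂ ^ (4 * A) * (L : ℝ) ^ 2) := by positivity
      nlinarith
    linarith

end Summit.Parity.GeneralizedHardyLittlewood.GreenTaoLevelTwoMNTwoQuadraticRecurrent
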